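import Summits.ResolutionOfSingularities.ResolutionOfSingularities.Theorems.FrobeniusLadderFInjectiveMacaulayficationFCUnguardedAprime
import Summits.ResolutionOfSingularities.ResolutionOfSingularities.Theorems.FrobeniusLadderFInjectiveMacaulayficationWFixAtNonClosedDimTwo
import Literature.AlgebraicGeometry.Resolution.BlowupsProduct
import Literature.AlgebraicGeometry.Resolution.BlowupsProperProofs
import Literature.AlgebraicGeometry.Resolution.BlowupsExistence
import Literature.AlgebraicGeometry.Resolution.StalkIdealLemmas
import Mathlib.AlgebraicGeometry.Morphisms.FiniteType
import Mathlib.Topology.JacobsonSpace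
import HarnessLib

/-!
# Blow-ups are local on the base (`goodOver_of_stalkIdeal_eq_pow_off_closed`) and the FINITE case of the relative fix (T3′) from the
# closed-point fix (T3): `relClosedSubsetFixFinite_of_relClosedFix` (crux `FInjectiveMacaulayfication` stmt-ResolutionOfSingularities-15315,
# chain w45a; res-L1-w45a-plan-1 R16.13 (5) / R16.15 (2b) «(T3) finite-Z kernel»; FC2Dim4Sig v0.7 docstring of `RelClosedSubsetFix`:
# «for FINITE `Z` this is (T3) `RelClosedFix` iterated»)

[OURS · L1 W4.5a · res-L1-w45a-stub-3] Support file (`--supports stmt-ResolutionOfSingularities-15315 --as helper`) for the crux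
`FrobeniusLadder.FInjectiveMacaulayfication`; NOT a statement of any manuscript; replaces the role of NOTHING in H. Hironaka's manuscript;
AI-written, weaker than expert review. Two `Prop`-valued CANDIDATE statements are declared (OURS, not facts; no instance, no notation):
(T3) `RelClosedFix` — the closed-point relative fix of FC2Dim4Sig v0.5/v0.7 (res-L1-w45a-strat-1 / stub-3), binder text VERBATIM, which the
tree-landing `…FCUnguardedAprime` (p566975) did not carry — and `RelClosedSubsetFixFinite` = (T3′) `FCUnguardedAprime.RelClosedSubsetFix` with
`Z.Finite →` inserted after `IsClosed Z →`. Everything else is proved; no named fact.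

CONTENT.
* §1 `isBlowup_pow_succ_iff` — `Bl_{Iᵏ⁺¹} = Bl_I` for blow-ups in the sense of the universal property (`IsBlowup`): the Cartier conditions
  for `I` and `Iᵏ⁺¹` agree (`IsEffectiveCartier.pow` / `of_mul_left`, Stacks 01WU / 07ZV), hence so do the universal properties.
* §2 **`goodOver_of_stalkIdeal_eq_pow_off_closed`** — BLOW-UPS ARE LOCAL ON THE BASE, in `GoodOver` currency: if `J ≡ J₀ⁿ⁺¹` stalkwise off a
  closed `T ⊆ X₁` (`X₁` locally Noetherian and Jacobson) and every blow-up along `J₀` is good over `S`, then every blow-up along `J` is good over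
  `S ∖ T`. Proof: a blow-up `π` along `J` restricts over `V = X₁ ∖ T` to a blow-up along `J|_V = J₀ⁿ⁺¹|_V` (`IsBlowup.restrict`, stalkwise
  comparison `ext_of_forall_stalkIdeal_eq`), i.e. along `J₀|_V` (§1); so does any blow-up `ρ` of `X₁` along `J₀` (`exists_isBlowup`), and the two
  agree over `V` up to a unique `V`-isomorphism (`IsBlowup.unique`), which matches points over `S ∖ T`, their local rings (stalk isomorphisms of
  open immersions) and — both total spaces being Jacobson (`IsBlowup.isProper` ⇒ locally of finite type over the Jacobson `X₁`) — their
  closed points (`IsOpenEmbedding.preimage_closedPoints`); `FullCl`/`CMCl` transport along ring isomorphisms. The exact form (`n = 0`) is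
  `goodOver_of_stalkIdeal_eq_off_closed`; the power form serves the residual of record `RelClosedSubsetFixPow` (res-L1-w45a-tri-2 20:14:32Z (d)).
* §3 `relClosedFix_step` + **`relClosedSubsetFixFinite_of_relClosedFix : RelClosedFix → RelClosedSubsetFixFinite`** — the finite case of (T3′)
  IS (T3) iterated: induct on the finite set `Z = {b} ∪ F` of closed points; apply (T3) at `b` with the punctured neighbourhood `X₁ ∖ F`; the
  new centre agrees with `J₀` off `b`, so by §2 it stays good wherever `J₀` was, off `b`; recurse on `F`.

References: The Stacks Project, Tags 0806 (universal property), 02OS, 080A/07ZV (powers), 02NS (properness); Görtz–Wedhorn I, Def. 13.90,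
Prop. 13.91. All statements are [folklore] scheme bookkeeping over the tree's `IsBlowup` API (`Blowups`, `BlowupsProduct`, `BlowupsExistence`,
`BlowupsProperProofs`) and Mathlib's `JacobsonSpace`.
-/

-- single-problem summit: the doubled namespace component is forced
set_option linter.dupNamespace false

noncomputable section

open AlgebraicGeometry CategoryTheory Literature.AlgebraicGeometry.Resolution TopologicalSpace IsLocalRing

namespace Summit.ResolutionOfSingularities.ResolutionOfSingularities.Theorems.FInjectiveMacaulayfication.RelClosedSubsetFixFinite

open Summit.ResolutionOfSingularities.ResolutionOfSingularities.Theorems.FInjectiveMacaulayfication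
open Summit.ResolutionOfSingularities.ResolutionOfSingularities.Theorems.FInjectiveMacaulayfication.SliceableCentre (CMCl FCl FullCl)

/-! ## §0 The statements: (T3) `RelClosedFix` (v0.7 text verbatim) and the finite case of (T3′) -/

/-- [OURS · CANDIDATE statement, not a fact — FC2Dim4Sig v0.5/v0.7 (T3), binder text verbatim; the OPEN special-point residual #4β♭]
**(T3) relative closed-point fix** — «modify `J₀` AT `b` only»: if every blow-up along `J₀` is already good over a punctured neighbourhood of
the closed point `b ∈ supp J₀`, then some `J` with the SAME stalks as `J₀` at every point `≠ b` (so the `J`'s for distinct special points glue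
trivially) and `b ∈ supp J` is good over a full neighbourhood of `b`: FULL at the NON-closed points above, CM at the closed ones. Why it might
fail: the correction must be `b`-supported AND compatible with the prescribed `J₀`, and the non-closed points of the new exceptional locus over
`b` (local rings of dimension ≤ 3 on a 4-fold, no longer essentially of finite type over a field along which CP could be spread) must all come
out FULL at once — an embedded #4β one notch weaker than #4β(4) in its conclusion and one notch harder in its constraint; no tool in print.
(res-L1-w45a-tri-2 TRIAGE v10.18 #122: read as the split T3⁰ — the bad locus of `Bl_{J₀}` over `b` is FINITE = #4β(4) verbatim, the live case —
/ T3⁺ — positive-dimensional bad locus over `b`, CARRIED = the regress class of ROUTES-DIM4 §5 / 𝒞₄); the `J₀ = ⊥` instance is junk-harmless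
(`b ∈ supp J₀` fails). [candidate statement, OURS; open] -/
@[conjecture] def RelClosedFix : Prop :=
  ∀ (p : ℕ), p.Prime → ∀ (k : Type) [Field k] [CharP k p]
    (X₁ : Scheme.{0}) (f₁ : X₁ ⟶ Spec (.of k)),
      IsSeparated f₁ → LocallyOfFiniteType f₁ → QuasiCompact f₁ → IsIntegral X₁ → 4 ≤ topologicalKrullDim X₁ →
      (∀ x : X₁, CMCl (X₁.presheaf.stalk x)) →
      ∀ (J₀ : X₁.IdealSheafData) (b : X₁), IsClosed ({b} : Set X₁) → b ∈ (J₀.support : Set X₁) →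
        (∃ W : X₁.Opens, b ∈ (W : Set X₁) ∧
          FCUnguardedAprime.GoodOver p X₁ J₀ (((J₀.support : Set X₁) ∩ (W : Set X₁)) \ {b})) →
        ∃ (J : X₁.IdealSheafData) (W' : X₁.Opens), b ∈ (W' : Set X₁) ∧ b ∈ (J.support : Set X₁) ∧
          (∀ x : X₁, x ≠ b → stalkIdeal J x = stalkIdeal J₀ x) ∧
          FCUnguardedAprime.GoodOver p X₁ J ((J.support : Set X₁) ∩ (W' : Set X₁))

/-- [OURS · CANDIDATE statement, not a fact] **(T3′-fin) the relative fix over a FINITE closed subset** — `FCUnguardedAprime.RelClosedSubsetFix`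
((T3′), FC2Dim4Sig v0.7, p566975) with `Z.Finite →` inserted after `IsClosed Z →`: if every blow-up along `J₀` is good over `supp J₀ ∖ Z` for a
FINITE closed `Z ⊆ supp J₀`, then some `J` with the same stalks as `J₀` off `Z` is good over all of `supp J`. PROVED below from (T3)
(`relClosedSubsetFixFinite_of_relClosedFix`) — the kernel form of v0.7's remark «for FINITE `Z` this is (T3) `RelClosedFix` iterated».
[candidate statement, OURS; THEOREM modulo (T3)] -/
@[conjecture] def RelClosedSubsetFixFinite : Prop :=
  ∀ (p : ℕ), p.Prime → ∀ (k : Type) [Field k] [CharP k p]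
    (X₁ : Scheme.{0}) (f₁ : X₁ ⟶ Spec (.of k)),
      IsSeparated f₁ → LocallyOfFiniteType f₁ → QuasiCompact f₁ → IsIntegral X₁ → 4 ≤ topologicalKrullDim X₁ →
      (∀ x : X₁, CMCl (X₁.presheaf.stalk x)) →
      ∀ (J₀ : X₁.IdealSheafData) (Z : Set X₁), IsClosed Z → Z.Finite → Z ⊆ (J₀.support : Set X₁) →
        FCUnguardedAprime.GoodOver p X₁ J₀ ((J₀.support : Set X₁) \ Z) →
        ∃ J : X₁.IdealSheafData, (∀ x : X₁, x ∉ Z → stalkIdeal J x = stalkIdeal J₀ x) ∧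
          FCUnguardedAprime.GoodOver p X₁ J (J.support : Set X₁)

/-- (T3′) implies its finite case. [plumbing] -/
theorem relClosedSubsetFixFinite_of_relClosedSubsetFix (h : FCUnguardedAprime.RelClosedSubsetFix) : RelClosedSubsetFixFinite :=
  fun p hp k _ _ X₁ f₁ hs hft hqc hi h4 hCM J₀ Z hZ _ hZJ hgood => h p hp k X₁ f₁ hs hft hqc hi h4 hCM J₀ Z hZ hZJ hgood

/-! ## §1 `Bl_{Iᵏ⁺¹} = Bl_I` -/

section Pow

variable {X' X : Scheme.{0}} (π : X' ⟶ X) (I : X.IdealSheafData)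

/-- The Cartier condition of the universal property is the same for `I` and `Iᵏ⁺¹` (Stacks 01WU, 07ZV). [folklore] -/
theorem isEffectiveCartier_comap_pow_succ_iff {W : Scheme.{0}} (f : W ⟶ X) (k : ℕ) :
    IsEffectiveCartier ((I ^ (k + 1)).comap f) ↔ IsEffectiveCartier (I.comap f) := by
  rw [comap_pow]
  refine ⟨fun h => ?_, fun h => h.pow (k + 1)⟩
  rw [pow_succ'] at h
  exact h.of_mul_left

/-- **`Bl_{Iᵏ⁺¹} = Bl_I`**: a morphism is a blow-up along `Iᵏ⁺¹` iff it is a blow-up along `I` (universal property; the Cartier conditions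
coincide). [cite: StacksProject, Tag 080A] -/
theorem isBlowup_pow_succ_iff (k : ℕ) : IsBlowup π (I ^ (k + 1)) ↔ IsBlowup π I := by
  constructor
  · intro h
    exact ⟨(isEffectiveCartier_comap_pow_succ_iff I π k).mp h.isEffectiveCartier,
      fun W f hf => h.universal f ((isEffectiveCartier_comap_pow_succ_iff I f k).mpr hf)⟩
  · intro h
    exact ⟨(isEffectiveCartier_comap_pow_succ_iff I π k).mpr h.isEffectiveCartier,
      fun W f hf => h.universal f ((isEffectiveCartier_comap_pow_succ_iff I f k).mp hf)⟩

end Pow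

/-! ## §2 Blow-ups are local on the base, in `GoodOver` currency -/

section Local

variable {X₁ : Scheme.{0}}

/-- Ideal sheaves that agree stalkwise on an open agree after restriction to it. [folklore] -/
theorem comap_ι_eq_of_forall_stalkIdeal_eq {J K : X₁.IdealSheafData} (V : X₁.Opens)
    (h : ∀ x : X₁, x ∈ (V : Set X₁) → stalkIdeal J x = stalkIdeal K x) : J.comap V.ι = K.comap V.ι :=
  ext_of_forall_stalkIdeal_eq fun y => by
    rw [stalkIdeal_comap_eq_map_stalkMap, stalkIdeal_comap_eq_map_stalkMap, h (V.ι y) (by simp)]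

/-- `FullCl` implies `CMCl`. [plumbing] -/
theorem cmCl_of_fullCl {p : ℕ} {A : Type} [CommRing A] (h : FullCl p A) : CMCl A :=
  fun d hd s hmax => (h.2 d hd s hmax).1

/-- **Point/stalk dictionary between two blow-ups that agree over an open.** Let `π : X₂ → X₁` and `ρ : X₂' → X₁` restrict over the open `V` to
blow-ups of `V` along the same ideal. Then every `x ∈ X₂` over `V` has a partner `x' ∈ X₂'` with the same image in `X₁`, an isomorphic local
ring, and — if `X₂` is Jacobson — `x` closed as soon as `x'` is. [folklore] -/
theorem exists_partner_of_isBlowup_restrict {X₂ X₂' : Scheme.{0}} (π : X₂ ⟶ X₁) (ρ : X₂' ⟶ X₁) (V : X₁.Opens) {K : (V : Scheme.{0}).IdealSheafData}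
    (hπ : IsBlowup (π ∣_ V) K) (hρ : IsBlowup (ρ ∣_ V) K) [JacobsonSpace X₂] (x : X₂) (hx : π.base x ∈ (V : Set X₁)) :
    ∃ x' : X₂', ρ.base x' = π.base x ∧ Nonempty (X₂'.presheaf.stalk x' ≃+* X₂.presheaf.stalk x) ∧
      (IsClosed ({x'} : Set X₂') → IsClosed ({x} : Set X₂)) := by
  obtain ⟨e, he, -⟩ := hπ.unique hρ
  have hxV : x ∈ π ⁻¹ᵁ V := hx
  let xt : ↥(π ⁻¹ᵁ V : Scheme.{0}) := ⟨x, hxV⟩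
  let y : ↥(ρ ⁻¹ᵁ V : Scheme.{0}) := e.hom.base xt
  refine ⟨y.1, ?_, ⟨?_⟩, fun hycl => ?_⟩
  · -- same image in `X₁`
    calc ρ.base y.1 = ((ρ ∣_ V).base y).1 := (morphismRestrict_base_coe ρ V y).symm
      _ = ((e.hom ≫ ρ ∣_ V).base xt).1 := by rw [Scheme.Hom.comp_apply]
      _ = ((π ∣_ V).base xt).1 := by rw [he]
      _ = π.base x := morphismRestrict_base_coe π V xt
  · -- isomorphic local rings: `𝒪_{X₂',y} ≅ 𝒪_{ρ⁻¹V,y} ≅ 𝒪_{π⁻¹V,x} ≅ 𝒪_{X₂,x}`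
    exact (((ρ ⁻¹ᵁ V).stalkIso y).symm ≪≫ asIso (e.hom.stalkMap xt) ≪≫ (π ⁻¹ᵁ V).stalkIso xt).commRingCatIsoToRingEquiv
  · -- closed points: `y` closed in `X₂'` ⇒ closed in `ρ⁻¹V` ⇒ `xt` closed in `π⁻¹V` ⇒ `x` closed in the Jacobson space `X₂`
    have h1 : IsClosed ({y} : Set ↥(ρ ⁻¹ᵁ V : Scheme.{0})) :=
      WFixAtNonClosedDimTwo.isClosed_singleton_restrict (ρ ⁻¹ᵁ V) y.2 hycl
    have h2 : IsClosed ({xt} : Set ↥(π ⁻¹ᵁ V : Scheme.{0})) := by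
      rw [← (Scheme.homeoOfIso e).isClosed_image, Set.image_singleton]
      exact h1
    have h3 : xt ∈ closedPoints ↥(π ⁻¹ᵁ V : Scheme.{0}) := h2
    rw [← (π ⁻¹ᵁ V).ι.isOpenEmbedding.preimage_closedPoints] at h3
    exact h3

/-- [OURS · L1 W4.5a] **Blow-ups are local on the base, `GoodOver` currency, power form**: if `stalkIdeal J x = (stalkIdeal J₀ x)ⁿ⁺¹` for every
`x` outside a closed `T ⊆ X₁` (`X₁` locally Noetherian and Jacobson), and every blow-up along `J₀` is FULL at the non-closed / CM at the
closed points over `S`, then every blow-up along `J` is so over `S ∖ T`. (A blow-up along `J` restricts over `X₁ ∖ T` to a blow-up along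
`J₀ⁿ⁺¹|`, i.e. along `J₀|`; compare with any blow-up of `X₁` along `J₀` by uniqueness; closed points correspond since blow-ups of `X₁` are proper,
hence their sources Jacobson.) [folklore; cite: GortzWedhorn2020, Prop. 13.91; StacksProject, Tag 080A] -/
theorem goodOver_of_stalkIdeal_eq_pow_off_closed [IsLocallyNoetherian X₁] [JacobsonSpace X₁] {p : ℕ} {J J₀ : X₁.IdealSheafData}
    {T : Set X₁} (hT : IsClosed T) (n : ℕ) (hJ : ∀ x : X₁, x ∉ T → stalkIdeal J x = stalkIdeal J₀ x ^ (n + 1)) {S : Set X₁}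
    (hgood : FCUnguardedAprime.GoodOver p X₁ J₀ S) : FCUnguardedAprime.GoodOver p X₁ J (S \ T) := by
  intro X₂ π hπ
  -- `V := X₁ ∖ T`; `π` restricts over `V` to a blow-up along `J₀|_V`
  let V : X₁.Opens := ⟨Tᶜ, hT.isOpen_compl⟩
  have hJV : J.comap V.ι = (J₀ ^ (n + 1)).comap V.ι :=
    comap_ι_eq_of_forall_stalkIdeal_eq V fun x hx => by rw [hJ x hx, stalkIdeal_pow]
  have hπV : IsBlowup (π ∣_ V) (J₀.comap V.ι) := by
    have h := hπ.restrict V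
    rw [hJV, comap_pow] at h
    exact (isBlowup_pow_succ_iff _ _ n).mp h
  -- any blow-up `ρ` of `X₁` along `J₀`, restricted over `V`
  obtain ⟨X₂', ρ, hρ⟩ := exists_isBlowup X₁ J₀
  have hρV : IsBlowup (ρ ∣_ V) (J₀.comap V.ι) := hρ.restrict V
  obtain ⟨hnc', hcl'⟩ := hgood X₂' ρ hρ
  haveI : JacobsonSpace X₂ := by
    haveI : IsProper π := hπ.isProper
    exact LocallyOfFiniteType.jacobsonSpace π
  refine ⟨fun x hx hxcl => ?_, fun x hx hxcl => ?_⟩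
  · obtain ⟨x', hxx', ⟨ε⟩, hclosed⟩ := exists_partner_of_isBlowup_restrict π ρ V hπV hρV x hx.2
    by_cases hx'cl : IsClosed ({x'} : Set X₂')
    · exact absurd (hclosed hx'cl) hxcl
    · exact WFixAtNonClosedDimTwo.fullCl_of_ringEquiv p ε (hnc' x' (hxx' ▸ hx.1) hx'cl)
  · obtain ⟨x', hxx', ⟨ε⟩, -⟩ := exists_partner_of_isBlowup_restrict π ρ V hπV hρV x hx.2
    by_cases hx'cl : IsClosed ({x'} : Set X₂')
    · exact FiLocusOpenOfAffine.cmClause_of_ringEquiv ε (hcl' x' (hxx' ▸ hx.1) hx'cl)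
    · exact FiLocusOpenOfAffine.cmClause_of_ringEquiv ε (cmCl_of_fullCl (hnc' x' (hxx' ▸ hx.1) hx'cl))

/-- [OURS · L1 W4.5a] **Blow-ups are local on the base, `GoodOver` currency, exact form** (`n = 0` of the power form): if `J` and `J₀` have the
same stalks outside a closed `T`, then `GoodOver p X₁ J₀ S → GoodOver p X₁ J (S ∖ T)`. [folklore; cite: GortzWedhorn2020, Prop. 13.91] -/
theorem goodOver_of_stalkIdeal_eq_off_closed [IsLocallyNoetherian X₁] [JacobsonSpace X₁] {p : ℕ} {J J₀ : X₁.IdealSheafData}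
    {T : Set X₁} (hT : IsClosed T) (hJ : ∀ x : X₁, x ∉ T → stalkIdeal J x = stalkIdeal J₀ x) {S : Set X₁}
    (hgood : FCUnguardedAprime.GoodOver p X₁ J₀ S) : FCUnguardedAprime.GoodOver p X₁ J (S \ T) :=
  goodOver_of_stalkIdeal_eq_pow_off_closed hT 0 (fun x hx => by rw [zero_add, pow_one]; exact hJ x hx) hgood

/-- `GoodOver` is antitone in the set. [plumbing] -/
theorem goodOver_mono {p : ℕ} {J : X₁.IdealSheafData} {S S' : Set X₁} (hSS' : S ⊆ S') (h : FCUnguardedAprime.GoodOver p X₁ J S') :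
    FCUnguardedAprime.GoodOver p X₁ J S := fun X₂ π hπ =>
  ⟨fun x hx hxcl => (h X₂ π hπ).1 x (hSS' hx) hxcl, fun x hx hxcl => (h X₂ π hπ).2 x (hSS' hx) hxcl⟩

/-- Stalkwise-equal ideal sheaves have the same support (pointwise). [plumbing] -/
theorem mem_support_iff_of_stalkIdeal_eq {J J₀ : X₁.IdealSheafData} {x : X₁} (h : stalkIdeal J x = stalkIdeal J₀ x) :
    x ∈ (J.support : Set X₁) ↔ x ∈ (J₀.support : Set X₁) := by
  change x ∈ J.support ↔ x ∈ J₀.support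
  rw [mem_support_iff_stalkIdeal_le, mem_support_iff_stalkIdeal_le, h]

end Local

/-! ## §3 The finite case of (T3′) is (T3) iterated -/

section Finite

variable {X₁ : Scheme.{0}} [IsLocallyNoetherian X₁] [JacobsonSpace X₁] {p : ℕ}

/-- **One step**: from (T3) at a closed point `b ∉ F` (`F` closed) — if every blow-up along `J₀` is good over `supp J₀ ∖ ({b} ∪ F)`, then some
`J ≡ J₀` off `b`, with `b ∈ supp J`, is good over `supp J ∖ F`. [folklore assembly, OURS] -/
theorem relClosedFix_step
    (hT3 : ∀ (J₀ : X₁.IdealSheafData) (b : X₁), IsClosed ({b} : Set X₁) → b ∈ (J₀.support : Set X₁) →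
      (∃ W : X₁.Opens, b ∈ (W : Set X₁) ∧ FCUnguardedAprime.GoodOver p X₁ J₀ (((J₀.support : Set X₁) ∩ (W : Set X₁)) \ {b})) →
      ∃ (J : X₁.IdealSheafData) (W' : X₁.Opens), b ∈ (W' : Set X₁) ∧ b ∈ (J.support : Set X₁) ∧
        (∀ x : X₁, x ≠ b → stalkIdeal J x = stalkIdeal J₀ x) ∧ FCUnguardedAprime.GoodOver p X₁ J ((J.support : Set X₁) ∩ (W' : Set X₁)))
    (J₀ : X₁.IdealSheafData) {b : X₁} (hb : IsClosed ({b} : Set X₁)) (hbJ : b ∈ (J₀.support : Set X₁)) {F : Set X₁} (hF : IsClosed F)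
    (hbF : b ∉ F) (hgood : FCUnguardedAprime.GoodOver p X₁ J₀ ((J₀.support : Set X₁) \ insert b F)) :
    ∃ J : X₁.IdealSheafData, b ∈ (J.support : Set X₁) ∧ (∀ x : X₁, x ≠ b → stalkIdeal J x = stalkIdeal J₀ x) ∧
      FCUnguardedAprime.GoodOver p X₁ J ((J.support : Set X₁) \ F) := by
  -- (T3) at `b` with the punctured neighbourhood `X₁ ∖ F`
  let W : X₁.Opens := ⟨Fᶜ, hF.isOpen_compl⟩
  have hW : FCUnguardedAprime.GoodOver p X₁ J₀ (((J₀.support : Set X₁) ∩ (W : Set X₁)) \ {b}) := by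
    refine goodOver_mono ?_ hgood
    intro x hx
    refine ⟨hx.1.1, ?_⟩
    rintro (rfl | hxF)
    · exact hx.2 rfl
    · exact hx.1.2 hxF
  obtain ⟨J, W', hbW', hbJ', hJeq, hJgood⟩ := hT3 J₀ b hb hbJ ⟨W, hbF, hW⟩
  refine ⟨J, hbJ', hJeq, fun X₂ π hπ => ?_⟩
  -- off `b`, `J ≡ J₀`, so blow-ups along `J` stay good wherever those along `J₀` were
  have hoff := goodOver_of_stalkIdeal_eq_off_closed (p := p) hb (fun x hx => hJeq x hx) hgood X₂ π hπ
  have hnear := hJgood X₂ π hπ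
  have key : ∀ x : X₂, π.base x ∈ (J.support : Set X₁) \ F → π.base x ∉ (W' : Set X₁) →
      π.base x ∈ ((J₀.support : Set X₁) \ insert b F) \ {b} := by
    intro x hx hxW'
    have hxb : π.base x ≠ b := fun h => hxW' (h ▸ hbW')
    refine ⟨⟨(mem_support_iff_of_stalkIdeal_eq (hJeq _ hxb)).mp hx.1, ?_⟩, hxb⟩
    rintro (h | h)
    · exact hxb h
    · exact hx.2 h
  refine ⟨fun x hx hxcl => ?_, fun x hx hxcl => ?_⟩
  · by_cases hxW' : π.base x ∈ (W' : Set X₁)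
    · exact hnear.1 x ⟨hx.1, hxW'⟩ hxcl
    · exact hoff.1 x (key x hx hxW') hxcl
  · by_cases hxW' : π.base x ∈ (W' : Set X₁)
    · exact hnear.2 x ⟨hx.1, hxW'⟩ hxcl
    · exact hoff.2 x (key x hx hxW') hxcl

/-- **The iteration** over a finite set of closed points. [folklore assembly, OURS] -/
theorem relClosedFix_iterate
    (hT3 : ∀ (J₀ : X₁.IdealSheafData) (b : X₁), IsClosed ({b} : Set X₁) → b ∈ (J₀.support : Set X₁) →
      (∃ W : X₁.Opens, b ∈ (W : Set X₁) ∧ FCUnguardedAprime.GoodOver p X₁ J₀ (((J₀.support : Set X₁) ∩ (W : Set X₁)) \ {b})) →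
      ∃ (J : X₁.IdealSheafData) (W' : X₁.Opens), b ∈ (W' : Set X₁) ∧ b ∈ (J.support : Set X₁) ∧
        (∀ x : X₁, x ≠ b → stalkIdeal J x = stalkIdeal J₀ x) ∧ FCUnguardedAprime.GoodOver p X₁ J ((J.support : Set X₁) ∩ (W' : Set X₁)))
    (s : Finset X₁) : ∀ (J₀ : X₁.IdealSheafData), (∀ b ∈ s, IsClosed ({b} : Set X₁)) → (↑s : Set X₁) ⊆ (J₀.support : Set X₁) →
      FCUnguardedAprime.GoodOver p X₁ J₀ ((J₀.support : Set X₁) \ ↑s) →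
      ∃ J : X₁.IdealSheafData, (∀ x : X₁, x ∉ (↑s : Set X₁) → stalkIdeal J x = stalkIdeal J₀ x) ∧
        FCUnguardedAprime.GoodOver p X₁ J (J.support : Set X₁) := by
  classical
  induction s using Finset.induction_on with
  | empty =>
    intro J₀ _ _ hgood
    refine ⟨J₀, fun _ _ => rfl, ?_⟩
    simpa using hgood
  | insert b s hbs ih =>
    intro J₀ hcl hsub hgood
    have hF : IsClosed (↑s : Set X₁) := by
      rw [← Set.biUnion_of_singleton (↑s : Set X₁)]
      exact s.finite_toSet.isClosed_biUnion fun x hx => hcl x (Finset.mem_insert_of_mem hx)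
    have hbF : b ∉ (↑s : Set X₁) := fun h => hbs (Finset.mem_coe.mp h)
    have hgood' : FCUnguardedAprime.GoodOver p X₁ J₀ ((J₀.support : Set X₁) \ insert b (↑s : Set X₁)) := by
      rw [← Finset.coe_insert]
      exact hgood
    obtain ⟨J₁, hbJ₁, hJ₁eq, hJ₁good⟩ := relClosedFix_step hT3 J₀ (hcl b (Finset.mem_insert_self b s))
      (hsub (Finset.mem_coe.mpr (Finset.mem_insert_self b s))) hF hbF hgood'
    have hsub₁ : (↑s : Set X₁) ⊆ (J₁.support : Set X₁) := fun x hx =>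
      (mem_support_iff_of_stalkIdeal_eq (hJ₁eq x fun h => hbF (h ▸ hx))).mpr
        (hsub (Finset.mem_coe.mpr (Finset.mem_insert_of_mem (Finset.mem_coe.mp hx))))
    obtain ⟨J, hJeq, hJgood⟩ := ih J₁ (fun x hx => hcl x (Finset.mem_insert_of_mem hx)) hsub₁ hJ₁good
    refine ⟨J, fun x hx => ?_, hJgood⟩
    rw [Finset.coe_insert, Set.mem_insert_iff, not_or] at hx
    rw [hJeq x hx.2, hJ₁eq x hx.1]

/-- In a Jacobson space the points of a finite closed subset are closed. [folklore] -/
theorem isClosed_singleton_of_mem_finite_isClosed {Y : Type} [TopologicalSpace Y] [JacobsonSpace Y] {Z : Set Y} (hZ : IsClosed Z)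
    (hZfin : Z.Finite) {b : Y} (hb : b ∈ Z) : IsClosed ({b} : Set Y) := by
  haveI : Finite Z := hZfin.to_subtype
  haveI : JacobsonSpace Z := JacobsonSpace.of_isClosedEmbedding hZ.isClosedEmbedding_subtypeVal
  have h : IsClosed (Subtype.val '' ({⟨b, hb⟩} : Set Z)) := hZ.isClosedMap_subtype_val _ (isClosed_discrete _)
  simpa using h

/-- [OURS · L1 W4.5a · THEOREM modulo (T3)] **The finite case of (T3′) is (T3) iterated** — `RelClosedFix → RelClosedSubsetFixFinite`: for a
FINITE closed `Z ⊆ supp J₀` over whose complement every blow-up along `J₀` is good, (T3) applied successively at the points of `Z` (closed, `X₁`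
being Jacobson), each time with the punctured neighbourhood `X₁ ∖ (rest of Z)`, produces `J ≡ J₀` off `Z` good over all of `supp J`; the
bookkeeping between steps is the base-locality of blow-ups (`goodOver_of_stalkIdeal_eq_off_closed`). [folklore assembly, OURS; no named fact] -/
theorem relClosedSubsetFixFinite_of_relClosedFix (h : RelClosedFix) : RelClosedSubsetFixFinite := by
  intro p hp k _ _ X₁ f₁ hs hft hqc hi h4 hCM J₀ Z hZcl hZfin hZsub hgood
  haveI : IsLocallyNoetherian X₁ := LocallyOfFiniteType.isLocallyNoetherian f₁
  haveI : JacobsonSpace X₁ := LocallyOfFiniteType.jacobsonSpace f₁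
  obtain ⟨s, rfl⟩ := hZfin.exists_finset_coe
  exact relClosedFix_iterate (p := p) (fun J₀' b hb hbJ hW => h p hp k X₁ f₁ hs hft hqc hi h4 hCM J₀' b hb hbJ hW) s J₀
    (fun b hb => isClosed_singleton_of_mem_finite_isClosed hZcl hZfin (Finset.mem_coe.mpr hb)) hZsub hgood

end Finite

end Summit.ResolutionOfSingularities.ResolutionOfSingularities.Theorems.FInjectiveMacaulayfication.RelClosedSubsetFixFinite

end
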